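import Literature.Topology.FourManifolds.FramedSpheresEvenFormPuncturedCylinder
import Literature.Topology.FourManifolds.FramedSpheresEvenFormHomology
import HarnessLib

/-!
# Framed spheres force an even intersection form (Wall 1964, the parity bridge in the proof of Thm. 2)

**Theorem** (`isEven_intersectionForm_of_forall_hasStableTangentFramingAlong`).  Let `X` be a
simply connected closed smooth 4-manifold such that every sphere map `h : S² → X` is stably
tangent-framed (the pull-back `h^* TX` is stably trivial).  Then the intersection form of `X` is
even, for every orientation.

This is the bridge between the two readings of "type II" used in the proof of Wall 1964, Thm. 2
(p. 145: "if the quadratic forms of two h-cobordant manifolds have the same type"): the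
*homotopy-theoretic* one (`w₂ = 0`, i.e. all sphere maps framed, which is what surgery on a
cobordism sees) and the *arithmetic* one (`Q_X` even).  Classically it is Wu's formula
`w₂ ⌣ x = x ⌣ x`; here it is proved geometrically, by assembling

* the geometric half `Literature.Topology.FourManifolds.exists_level_puncturedCylinder_isEven`:
  the punctured cylinder `W' = (X × [0, 1]) ∖ D⁵ : S⁴ ⇝ X ⊔ X` is simply connected with framed
  interior spheres, so it carries a nice Morse function with all indices `≥ 2` whose middle level
  `N = S⁴ # k(S² × S²)` has even intersection form (Kirby 1989, Ch. X; Wall 1964, Lemma 3);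
* the homological half
  `Literature.Topology.FourManifolds.Cobordism.IsNiceMorseFunction.isEven_intersectionForm_of_level_half`:
  evenness climbs from the middle level to the top `X ⊔ X` through the handles of index `≥ 3`
  (Milnor 1965, Thm. 7.4; Thom's isotropy).

## References

* C. T. C. Wall, *On simply-connected 4-manifolds*, J. London Math. Soc. 39 (1964) 141–149,
  proof of Thm. 2 (p. 145) and Lemma 3 (p. 146). [WallJLMS1964]
* R. C. Kirby, *The topology of 4-manifolds*, LNM 1374 (1989), Ch. X. [Kirby1989]
* J. Milnor, *Lectures on the h-cobordism theorem*, Princeton (1965), Thm. 7.4. [MilnorHCobordism1965]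
-/

open scoped Manifold ContDiff Topology
open Set Function
open Literature.AlgebraicTopology.SingularHomology

noncomputable section

namespace Literature.Topology.FourManifolds

/-- **Framed spheres force an even form** (the parity bridge of Wall 1964, proof of Thm. 2): if
every sphere map into the simply connected closed smooth 4-manifold `X` is stably tangent-framed,
then the intersection form of `X` is even for every orientation `μ`.  Proof: the geometric half
`exists_level_puncturedCylinder_isEven` and the homological half
`Cobordism.IsNiceMorseFunction.isEven_intersectionForm_of_level_half` (module docstring).
[cite: WallJLMS1964, proof of Thm. 2 (p. 145) with Lemma 3 (p. 146)] [cite: Kirby1989, Ch. X, proof of Thm. 1 (p. 55)] -/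
theorem isEven_intersectionForm_of_forall_hasStableTangentFramingAlong
    {X : Type} [TopologicalSpace X] [T2Space X] [SecondCountableTopology X]
    [ChartedSpace (EuclideanSpace ℝ (Fin 4)) X] [IsManifold (𝓡 4) ∞ X] [CompactSpace X]
    [SimplyConnectedSpace X]
    (hX : ∀ h : C((Metric.sphere (0 : EuclideanSpace ℝ (Fin (2 + 1))) 1), X),
      HasStableTangentFramingAlong (𝓡 4) X h)
    (μ : HomologicalOrientation ℤ X 4) : (intersectionForm two_add_two_eq_four μ).IsEven := by
  obtain ⟨D, g, N, i₁, i₂, i₃, i₄, i₅, i₆, e, -, hg, h2, he, her, heven⟩ :=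
    exists_level_puncturedCylinder_isEven hX
  haveI : SimplyConnectedSpace (Metric.sphere (0 : EuclideanSpace ℝ (Fin (4 + 1))) 1) :=
    Literature.AlgebraicTopology.FundamentalGroup.simplyConnectedSpace_euclideanSphere 4
      (by norm_num)
  exact hg.isEven_intersectionForm_of_level_half h2 e he.isEmbedding her heven μ

/-- **Spin implies even, for simply connected closed smooth 4-manifolds** — the `→` direction of
Kirby 1989, Ch. II Lemma 4.1 (*"if `H₁(M; ℤ) = 0` then `ω₂ = 0` iff the intersection form is
even"*) in the tree's language (`Literature.Topology.FourManifolds.IsSpin`: `T X ⊕ ℝ` framed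
along every closed-surface map, in particular along every sphere map); a special case of the named
fact `Literature.Topology.FourManifolds.isEven_intersectionForm_of_isSpin` (which has no
hypothesis on `π₁`). [cite: Kirby1989, Ch. II Lemma 4.1 (p. 23)] -/
theorem isEven_intersectionForm_of_isSpin_of_simplyConnectedSpace
    {X : Type} [TopologicalSpace X] [T2Space X] [SecondCountableTopology X]
    [ChartedSpace (EuclideanSpace ℝ (Fin 4)) X] [IsManifold (𝓡 4) ∞ X] [CompactSpace X]
    [SimplyConnectedSpace X] (hX : IsSpin (𝓡 4) X)
    (μ : HomologicalOrientation ℤ X 4) : (intersectionForm two_add_two_eq_four μ).IsEven :=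
  isEven_intersectionForm_of_forall_hasStableTangentFramingAlong (fun h => hX.2 _ h) μ

end Literature.Topology.FourManifolds

end
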